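/-
Origin: expansion seat `prover-pub-hodgecm-mc-binder-2-g18-0`, handover #96 2026-08-20T22:11Z md5 39fa3ab1a3e7 (NEW; 114 l.; ns `HodgeCM.SignRecipe` + `HodgeCM.Model`; (J4a-pin) RESCALING: `im_embedding_eta_mul_mul` (`Im τ(η (r a)) = Re τ(r) · Im τ(η a)`, `r̄ = r`), **`lineType_mul_eq_of_pos`** (`Φ^δ(r a) = Φ^δ(a)` for `r` totally real with `0 < Re τ(r)` at every `τ`), `conj_mul_eq_of_conj_eq`, `conj_mul_conj_self`, `re_embedding_mul_conj_self_pos` (`0 < Re τ(z z̄)` for `z ≠ 0`), **`lineType_mul_conj_mul_eq`** (`Φ^δ(z z̄ a) = Φ^δ(a)`) — theta-3-g26 K0 (3)(b): the slot scalar is determined up to `(L⁺)^×_{≫0} · Nm(L^×)` and `Φ^δ` is invariant under exactly that; and #94's (J4a)∕socket lemmas from the TYPE equation instead of the scalar equation: `Model.liftTyped_of_lineType_eq (… (hμ : lineType (scalar μ) _ _ = lineType (c.D.a i) _ _) : ∃ j, ι₁.comp j = c.σ ∧ typeOf μ = liftType false c.K L j ι₁ (c.Ψ i))`, `Model.hJ_at_of_lineType_eq`.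 Imports #94 only. CERT lane farm lean-direct over the RUN-63 PKG oleans + overlay oleans #92 ∕ #94 (RUN-64 bytes as installed, `g18/certs/instcheck64.txt`): rc 0 ∕ 5 s ∕ 0 warn ∕ 0 proof holes; `#print axioms` 8 ∕ 8 ⊆ trio (`g18/farm/logs/ax_sc.log` 4ba6b58df068); FQN 0 ∕ 8. NAME LIST (theorems): `HodgeCM.SignRecipe.lineType_mul_eq_of_pos` · `HodgeCM.SignRecipe.lineType_mul_conj_mul_eq` · `HodgeCM.Model.hJ_at_of_lineType_eq`. (`HOME/mc/pub-hodgecm-mc-binder-2/g18/stage65/HodgeCM/Model/Binders/JLiuLineTypeScale.lean`, md5 39fa3ab1a3e7, 114 lines);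
landed by the gen-27 packager (p-g27) in gate run 65 as `HodgeCM/Model/Binders/JLiuLineTypeScale.lean` (verbatim).
-/
/-
Copyright (c) 2026 the pub-hodgecm formalisation cell (harness21).  New file, not vendored.
Origin: session prover-pub-hodgecm-mc-binder-2-g18-0 (unit pub-hodgecm-mc-binder-2-g18, BINDER PROVER gen 18 of lineage mc-binder-2;
content lane (J-Liu-Θ), (J4a-pin) — the δ-positive type `Φ^δ(a)` is invariant under the group `(L⁺)^×_{≫0} · Nm_{L/L⁺}(L^×)` and the
(J4a) clause from a TYPE equation), 2026-08-20.  Intended final place: `HodgeCM/Model/Binders/JLiuLineTypeScale.lean` (NEW additive leaf;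
imports binder-2 #94 `Model/Binders/JLiuLineType` (RUN 64) only; nothing imports it).
-/
import Summits.HodgeConjecture.HodgeCM.Model.Binders.JLiuLineType

set_option autoImplicit false

/-!
# `Φ^δ(a)` under rescaling of the line scalar, and the (J4a) clause from `Φ^δ(scalar μ) = Φ^δ(a_i)`

theta-3-g26's K0 word (STATUS 2026-08-20T22:07:03Z (3)(b)): [Liu21]'s reading (L5) consumes only the SIGNS of `Im τ(η_L a)`, so the line
scalar of a slot is determined up to the group `(L⁺)^×_{≫0} · Nm_{L/L⁺}(L^×)`.  This leaf records that binder-2 #94's `SignRecipe.lineType`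
is invariant under exactly these rescalings, and restates #94's (J4a)/socket lemmas with the scalar EQUATION `scalar μ = c.D.a i` weakened
to the TYPE equation `Φ^δ(scalar μ) = Φ^δ(c.D.a i)` (so an index whose Gram line is a rescaled `a_i` is served as well):

* `lineType_mul_eq_of_pos` — `Φ^δ(r a) = Φ^δ(a)` for `r` totally real and totally positive (`0 < Re τ(r)` at every `τ`);
* `lineType_mul_conj_mul_eq` — `Φ^δ(z z̄ a) = Φ^δ(a)` for `z ≠ 0` (norms from `L`);
* `Model.liftTyped_of_lineType_eq`, `Model.hJ_at_of_lineType_eq` — #94 `liftTyped_of_scalar_eq` ∕ `hJ_at_of_scalar_eq` from the type equation.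
KERNEL: theorems only; 0 records, nothing cited, no `def … : Prop`; expected `#print axioms` ⊆ {propext, Classical.choice, Quot.sound}.
-/

noncomputable section

open NumberField NumberField.ComplexEmbedding
open Literature.AlgebraicGeometry.Motives (CMType)
open Literature.AlgebraicGeometry.ShimuraVarieties (conjRingHomK embedding_conjRingHomK)

namespace HodgeCM

namespace SignRecipe

variable {L : CMField}

/-- `Im τ(η (r a)) = Re τ(r) · Im τ(η a)` for `r` totally real. -/
theorem im_embedding_eta_mul_mul {r : L} (hr : conjRingHomK L r = r) (a : L) (τ : L →+* ℂ) :
    (τ (eta L * (r * a))).im = (τ r).re * (τ (eta L * a)).im := by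
  have hre : (τ r).im = 0 := im_embedding_eq_zero_of_conj_eq hr τ
  rw [show eta L * (r * a) = r * (eta L * a) by ring, map_mul, Complex.mul_im, hre, zero_mul, add_zero]

/-- **`Φ^δ(r · a) = Φ^δ(a)` for `r` totally real and totally positive.** -/
theorem lineType_mul_eq_of_pos {r a : L} (hr : conjRingHomK L r = r) (hpos : ∀ τ : L →+* ℂ, 0 < (τ r).re)
    (ha : conjRingHomK L a = a) (ha0 : a ≠ 0) (hra : conjRingHomK L (r * a) = r * a) (hra0 : r * a ≠ 0) :
    lineType (r * a) hra hra0 = lineType a ha ha0 := by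
  apply Subtype.ext
  ext τ
  change 0 < (τ (eta L * (r * a))).im ↔ 0 < (τ (eta L * a)).im
  rw [im_embedding_eta_mul_mul hr a τ]
  exact ⟨fun h => pos_of_mul_pos_right h (hpos τ).le, fun h => mul_pos (hpos τ) h⟩

/-- the side conditions of `Φ^δ(r a)` from those of `r` and `a` -/
theorem conj_mul_eq_of_conj_eq {r a : L} (hr : conjRingHomK L r = r) (ha : conjRingHomK L a = a) :
    conjRingHomK L (r * a) = r * a := by rw [map_mul, hr, ha]

/-- `z z̄` is totally real … -/
theorem conj_mul_conj_self (z : L) : conjRingHomK L (z * conjRingHomK L z) = z * conjRingHomK L z := by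
  rw [map_mul, conjRingHomK_apply L (conjRingHomK L z), conjRingHomK_apply L z, IsCMField.complexConj_apply_apply,
    mul_comm]

/-- … and totally positive for `z ≠ 0`: `Re τ(z z̄) = |τ z|² > 0`. -/
theorem re_embedding_mul_conj_self_pos {z : L} (hz : z ≠ 0) (τ : L →+* ℂ) :
    0 < (τ (z * conjRingHomK L z)).re := by
  rw [map_mul, embedding_conjRingHomK, Complex.mul_conj, Complex.ofReal_re]
  exact Complex.normSq_pos.mpr ((map_ne_zero τ).mpr hz)

/-- **`Φ^δ(z z̄ · a) = Φ^δ(a)` for `z ≠ 0`** (norm rescalings). -/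
theorem lineType_mul_conj_mul_eq {z a : L} (hz : z ≠ 0) (ha : conjRingHomK L a = a) (ha0 : a ≠ 0)
    (hza : conjRingHomK L (z * conjRingHomK L z * a) = z * conjRingHomK L z * a) (hza0 : z * conjRingHomK L z * a ≠ 0) :
    lineType (z * conjRingHomK L z * a) hza hza0 = lineType a ha ha0 :=
  lineType_mul_eq_of_pos (conj_mul_conj_self z) (re_embedding_mul_conj_self_pos hz) ha ha0 hza hza0

end SignRecipe

namespace Model

open HodgeCM.SignRecipe (lineType liftType)

variable {L : CMField} {ι₁ : L →+* ℂ}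

/-- **(J4a) from a TYPE equation**: as #94 `liftTyped_of_scalar_eq`, with `scalar μ = c.D.a i` weakened to
`Φ^δ(scalar μ) = Φ^δ(c.D.a i)` (rescaled Gram lines). -/
theorem liftTyped_of_lineType_eq {Char : Type*} (scalar : Char → L) (hreal : ∀ μ, conjRingHomK L (scalar μ) = scalar μ)
    (hne : ∀ μ, scalar μ ≠ 0) (typeOf : Char → CMType L)
    (htypeOf : ∀ μ, typeOf μ = lineType (scalar μ) (hreal μ) (hne μ))
    {c : SeesawCtx L} (hN : IsNormalClosure ℚ c.K L) (hc : SignRecipe.GoodCtx (Model.orientBitι L ι₁) ι₁ c) {i : Fin 4}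
    {μ : Char} (hμ : lineType (scalar μ) (hreal μ) (hne μ) = lineType (c.D.a i) (c.D.a_real i) (c.D.a_ne i)) :
    ∃ j : c.K →+* L, ι₁.comp j = c.σ ∧ typeOf μ = liftType false c.K L j ι₁ (c.Ψ i) := by
  obtain ⟨j, hj, hji⟩ := SignRecipe.GoodCtx.liftTyped_lineType_of_isNormalClosure hN hc i
  exact ⟨j, hj, by rw [htypeOf μ, hμ]; exact hji⟩

/-- **THE SOCKET FROM A TYPE EQUATION** (#94 `hJ_at_of_scalar_eq` with the scalar equation weakened to `Φ^δ(scalar μ) = Φ^δ(c.D.a i)`). -/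
theorem hJ_at_of_lineType_eq {Char : Type*} (PhiMu : Char → Prop) (adm : Char → LiuCMSide → Prop)
    (scalar : Char → L) (hreal : ∀ μ, conjRingHomK L (scalar μ) = scalar μ) (hne : ∀ μ, scalar μ ≠ 0)
    (typeOf : Char → CMType L) (htypeOf : ∀ μ, typeOf μ = lineType (scalar μ) (hreal μ) (hne μ))
    (hPhi : ∀ μ, ι₁ ∈ (typeOf μ).1 → PhiMu μ) (hadm : ∀ μ d, adm μ d → d.IsReflexOfTypeG ι₁ (typeOf μ))
    {c : SeesawCtx L} (hc : SignRecipe.GoodCtx (Model.orientBitι L ι₁) ι₁ c)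
    (h6 : Module.finrank ℚ c.K = 6 ∧ IsNormalClosure ℚ c.K L ∧ (Module.finrank ℚ L = 24 ∨ Module.finrank ℚ L = 48))
    {i : Fin 4} (Q : Finset Char → Prop)
    (hJS : ∃ S : Finset Char,
      (∀ μ ∈ S, lineType (scalar μ) (hreal μ) (hne μ) = lineType (c.D.a i) (c.D.a_real i) (c.D.a_ne i)) ∧ Q S) :
    ∃ S : Finset Char,
      (∀ μ ∈ S, PhiMu μ) ∧ (∀ μ ∈ S, ∀ d : LiuCMSide, adm μ d → d.IsCorner c.K (c.Ψ i) c.σ) ∧ Q S := by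
  obtain ⟨S, hS, hQ⟩ := hJS
  exact hJ_at_of_liftTyped PhiMu adm typeOf hPhi hadm (hc.mem i) h6 Q
    ⟨S, fun μ hμ => liftTyped_of_lineType_eq scalar hreal hne typeOf htypeOf h6.2.1 hc (hS μ hμ), hQ⟩

end Model

end HodgeCM

end
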